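import Mathlib
import Literature.MathematicalPhysics.StatisticalMechanics.BarlowStacking
import Summits.AtomisticToContinuum.Crystallization.Theses.ChessboardParticlePlanes

/-!
# Sketch — first lemmas of the crux ideas for `LjBilayerHcp` (stmt-AtomisticToContinuum-6710), ideator k = 1

Statements only (no proofs are claimed); every constant is an existing declaration.
-/

namespace Summit.AtomisticToContinuum.Crystallization.Cruxes.LjBilayerHcp.SketchIdeatorOne

open Literature.MathematicalPhysics.StatisticalMechanics

noncomputable section

/-! ## Shared vocabulary: the competitor class of the crux, site energies -/

/-- `B` is an `r`-separated period-2 stack with plane spacing `c` (the hypothesis class of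
`ChessboardParticlePlanes.LjBilayerHcp`, verbatim, with `3/4 ≤ c` kept outside). -/
def IsPeriodTwoStack (r c : ℝ) (B : PeriodicConfiguration 3) : Prop :=
  (∀ x ∈ B.points, ∀ y ∈ B.points, x ≠ y → r ≤ dist x y) ∧
  ∃ t : ℝ, (∀ x ∈ B.points, ∃ k : ℤ, x 2 = t + c * (k : ℝ)) ∧
    (∀ x ∈ B.points, x + (2 * c) • EuclideanSpace.single (2 : Fin 3) (1 : ℝ) ∈ B.points ∧
      x - (2 * c) • EuclideanSpace.single (2 : Fin 3) (1 : ℝ) ∈ B.points)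

/-- Full site energy `ε_x = Σ_{y ∈ B, y ≠ x} V(|x - y|)` (so that `e(B) = (2N)⁻¹ Σ_{x ∈ motif} ε_x`). -/
def siteEnergy (V : ℝ → ℝ) (B : PeriodicConfiguration 3) (x : EuclideanSpace ℝ (Fin 3)) : ℝ :=
  ∑' y : {y : EuclideanSpace ℝ (Fin 3) // y ∈ B.points ∧ y ≠ x}, V (dist x y.1)

/-- Self-orbit interaction `s = Σ_{g ∈ L ∖ 0} V(|g|)` (the same for every point). -/
def selfOrbitEnergy (V : ℝ → ℝ) (B : PeriodicConfiguration 3) : ℝ :=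
  ∑' g : {g : EuclideanSpace ℝ (Fin 3) // g ∈ B.lattice ∧ g ≠ 0}, V ‖g.1‖

/-! ## Card A (`euler-taxed-star-census`): first lemmas -/

/-- **Crossing lemma** (planarity of the short unlike-bond graph). If `p, r` are one species and
`q, s` the other, same-species pairs are `δ`-separated and the two unlike bonds `pq`, `rs` are
shorter than `δ`, then the projected bonds do not cross (indeed do not meet):
`|pr| + |qs| ≤ |pq| + |rs| < 2δ` at a common point. Gives the Euler census
`#(short unlike bonds) ≤ 2N` (planar bipartite) used by the star/host-triangle scores. -/
def UnlikeBondsDoNotCross : Prop :=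
  ∀ (p q r s : EuclideanSpace ℝ (Fin 2)) (δ : ℝ),
    δ ≤ dist p r → δ ≤ dist q s → dist p q < δ → dist r s < δ →
      Disjoint (segment ℝ p q) (segment ℝ r s)

/-- The same in any real normed space (the proof only uses `dist_add_dist_of_mem_segment`). -/
def UnlikeBondsDoNotCross' : Prop :=
  ∀ (E : Type) [NormedAddCommGroup E] [NormedSpace ℝ E] (p q r s : E) (δ : ℝ),
    δ ≤ dist p r → δ ≤ dist q s → dist p q < δ → dist r s < δ →
      Disjoint (segment ℝ p q) (segment ℝ r s)

/-- **Pruning lemma** (class-preserving deletion; the entry point of every local census).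
Deleting the orbit of a motif point `x` keeps the class and does not raise the energy per particle
as soon as `e(B) ≤ ε_x − s/2` (exact criterion: `e' = (N e − ε_x + s/2)/(N − 1)`), provided the
period-2 translation is a lattice vector (WLOG: `B.points` is invariant under it, so the lattice
may be enlarged). Consequence: a counterexample to the crux may be assumed to have
`ε_x − s/2 < e(B) < e(hcp)` at every site — every particle bound, soft separation profile. -/
def PruningLemma : Prop :=
  ∀ (r c : ℝ) (B : PeriodicConfiguration 3), IsPeriodTwoStack r c B →
    (2 * c) • EuclideanSpace.single (2 : Fin 3) (1 : ℝ) ∈ B.lattice → 2 ≤ B.motif.card →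
    ∀ x ∈ B.motif,
      B.energyPerParticle lennardJones ≤ siteEnergy lennardJones B x - selfOrbitEnergy lennardJones B / 2 →
      ∃ B' : PeriodicConfiguration 3, B'.lattice = B.lattice ∧ B'.motif = B.motif.erase x ∧
        IsPeriodTwoStack r c B' ∧
        B'.energyPerParticle lennardJones ≤ B.energyPerParticle lennardJones

/-- The crux restated over the named class (definitionally the route decl with the class
hypotheses bundled): what every line must conclude. -/
def CruxOverClass : Prop :=
  ∃ a h : ℝ, ∃ (ha : a ≠ 0) (hh : h ≠ 0), 47 / 50 ≤ a ∧ a ≤ 1 ∧ 39 / 50 * a ≤ h ∧ h ≤ 17 / 20 * a ∧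
    ∀ (c : ℝ) (B : PeriodicConfiguration 3), 3 / 4 ≤ c → IsPeriodTwoStack (2 / 3) c B →
      (hcpPeriodicConfiguration ha hh).energyPerParticle lennardJones ≤ B.energyPerParticle lennardJones

theorem cruxOverClass_iff :
    CruxOverClass ↔ Summit.AtomisticToContinuum.Crystallization.Theses.ChessboardParticlePlanes.LjBilayerHcp := by
  unfold CruxOverClass IsPeriodTwoStack
    Summit.AtomisticToContinuum.Crystallization.Theses.ChessboardParticlePlanes.LjBilayerHcp
  constructor
  · rintro ⟨a, h, ha, hh, h1, h2, h3, h4, H⟩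
    refine ⟨a, h, ha, hh, h1, h2, h3, h4, fun B hsep ⟨t, c, hc, hpl, hinv⟩ => H c B hc ⟨hsep, t, hpl, hinv⟩⟩
  · rintro ⟨a, h, ha, hh, h1, h2, h3, h4, H⟩
    refine ⟨a, h, ha, hh, h1, h2, h3, h4, fun c B hc ⟨hsep, t, hpl, hinv⟩ => H B hsep ⟨t, c, hc, hpl, hinv⟩⟩

/-! ## Card B (`slab-magic-pair`): first lemma -/

/-- Block positive-definiteness of a two-species kernel pair `(g₀, g₁)` on the plane: every finite
two-coloured real quadratic form is non-negative (Bochner: the `2 × 2` matrix of Fourier transforms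
`[[ĝ₀, ĝ₁], [ĝ₁, ĝ₀]]` is positive semidefinite, i.e. `ĝ₀ ≥ |ĝ₁|`). -/
def BlockPosDef (g₀ g₁ : EuclideanSpace ℝ (Fin 2) → ℝ) : Prop :=
  ∀ (n : ℕ) (x : Fin n → EuclideanSpace ℝ (Fin 2)) (col : Fin n → Bool) (a : Fin n → ℝ),
    0 ≤ ∑ i, ∑ j, a i * a j * (if col i = col j then g₀ (x i - x j) else g₁ (x i - x j))

/-- **Finite two-species zero-pressure Bochner bound** (Cohn–Kumar Prop. 9.3 / Fisher–Ruelle, with no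
density term, for two colours): if `(g₀, g₁)` is block positive-definite, `g₀ ≤ K₀` on like
differences of norm `≥ δ` and `g₁ ≤ K₁` everywhere, then every finite two-coloured configuration
with `δ`-separated like pairs has `Σ_{i ≠ j} K ≥ −n·g₀(0)`. Applied to blocks of a period-2 stack
in the ROD PICTURE (`K₀(ρ) = Σ_{k even} V(√(ρ² + k²c²))`, `K₁(ρ) = Σ_{k odd} V(√(ρ² + k²c²))`,
like rods = same parity) it gives `e(B) ≥ −g₀(0)/2 + ½ Σ_{k ≠ 0 even} V(|k| c)` for every
period-2 stack of spacing `c`. -/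
def FiniteSlabBochnerBound : Prop :=
  ∀ (g₀ g₁ K₀ K₁ : EuclideanSpace ℝ (Fin 2) → ℝ) (δ : ℝ), BlockPosDef g₀ g₁ →
    (∀ z, δ ≤ ‖z‖ → g₀ z ≤ K₀ z) → (∀ z, g₁ z ≤ K₁ z) →
    ∀ (n : ℕ) (x : Fin n → EuclideanSpace ℝ (Fin 2)) (col : Fin n → Bool),
      (∀ i j, i ≠ j → col i = col j → δ ≤ dist (x i) (x j)) →
      -((n : ℝ) * g₀ 0) ≤
        ∑ i, ∑ j, if i = j then 0 else (if col i = col j then K₀ (x i - x j) else K₁ (x i - x j))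

/-- The rod kernels of the rod picture: interaction of two vertical rods of spacing `2c` at
in-plane offset `z`, same parity (`K₀`, the `k = 0` term being the in-plane pair) or opposite
parity (`K₁`). -/
def rodKernelEven (V : ℝ → ℝ) (c : ℝ) (z : EuclideanSpace ℝ (Fin 2)) : ℝ :=
  ∑' k : ℤ, V (Real.sqrt (‖z‖ ^ 2 + (2 * c * k) ^ 2))

def rodKernelOdd (V : ℝ → ℝ) (c : ℝ) (z : EuclideanSpace ℝ (Fin 2)) : ℝ :=
  ∑' k : ℤ, V (Real.sqrt (‖z‖ ^ 2 + (c * (2 * k + 1)) ^ 2))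

/-- The TRANSFER target `C⁺` of card B (stronger than the crux at the spacings where it is asserted):
a zero-pressure MAGIC PAIR for the rod kernels at spacing `c` — block positive-definite, minorising
(`g₀ ≤ K₀` on `‖z‖ ≥ 2/3`, `g₁ ≤ K₁`), whose Bochner value `−g₀(0)/2 + (self-rod term)/2` reaches
the hcp energy. (The crude complement for `c` outside a compact window is a separate, easy item.) -/
def SlabMagicPairAt (c : ℝ) (e : ℝ) : Prop :=
  ∃ g₀ g₁ : EuclideanSpace ℝ (Fin 2) → ℝ, BlockPosDef g₀ g₁ ∧
    (∀ z, (2 : ℝ) / 3 ≤ ‖z‖ → g₀ z ≤ rodKernelEven lennardJones c z) ∧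
    (∀ z, g₁ z ≤ rodKernelOdd lennardJones c z) ∧
    e ≤ -(g₀ 0) / 2 + (∑' k : ℤ, if k = 0 then 0 else lennardJones (|2 * c * (k : ℝ)|)) / 2

end

end Summit.AtomisticToContinuum.Crystallization.Cruxes.LjBilayerHcp.SketchIdeatorOne

namespace Summit.AtomisticToContinuum.Crystallization.Cruxes.LjBilayerHcp.SketchIdeatorOne

/-- Proof of the crossing lemma (card A's first lemma), in every real normed space. -/
theorem unlikeBondsDoNotCross' : UnlikeBondsDoNotCross' := by
  intro E _ _ p q r s δ hpr hqs hpq hrs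
  rw [Set.disjoint_left]
  intro o ho ho'
  have h1 : dist p o + dist o q = dist p q := dist_add_dist_of_mem_segment ho
  have h2 : dist r o + dist o s = dist r s := dist_add_dist_of_mem_segment ho'
  have h3 : dist p r ≤ dist p o + dist o r := dist_triangle p o r
  have h4 : dist q s ≤ dist q o + dist o s := dist_triangle q o s
  have h5 : dist o r = dist r o := dist_comm o r
  have h6 : dist q o = dist o q := dist_comm q o
  linarith

theorem unlikeBondsDoNotCross : UnlikeBondsDoNotCross := fun p q r s δ =>
  unlikeBondsDoNotCross' (EuclideanSpace ℝ (Fin 2)) p q r s δ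

/-- Proof of card B's first lemma (finite two-species zero-pressure Bochner bound). -/
theorem finiteSlabBochnerBound : FiniteSlabBochnerBound := by
  intro g₀ g₁ K₀ K₁ δ hpd h₀ h₁ n x col hsep
  have key : ∀ i j : Fin n, (if i = j then 0 else
      (if col i = col j then K₀ (x i - x j) else K₁ (x i - x j))) ≥
      (1 : ℝ) * 1 * (if col i = col j then g₀ (x i - x j) else g₁ (x i - x j)) -
        (if i = j then g₀ 0 else 0) := by
    intro i j
    by_cases hij : i = j
    · subst hij; simp
    · simp only [hij, if_false, one_mul, sub_zero]
      by_cases hc : col i = col j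
      · simp only [hc, if_true]
        apply h₀
        have := hsep i j hij hc
        rwa [dist_eq_norm] at this
      · simp only [hc, if_false]
        exact h₁ _
  have hsum := Finset.sum_le_sum fun i (_ : i ∈ Finset.univ) =>
    Finset.sum_le_sum fun j (_ : j ∈ Finset.univ) => key i j
  have hpos := hpd n x col (fun _ => 1)
  have hdiag : ∑ i : Fin n, ∑ j : Fin n, (if i = j then g₀ 0 else (0 : ℝ)) = n * g₀ 0 := by
    simp
  rw [show (∑ i : Fin n, ∑ j : Fin n, ((1 : ℝ) * 1 *
      (if col i = col j then g₀ (x i - x j) else g₁ (x i - x j)) - (if i = j then g₀ 0 else 0)))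
      = (∑ i : Fin n, ∑ j : Fin n, (1 : ℝ) * 1 *
          (if col i = col j then g₀ (x i - x j) else g₁ (x i - x j))) -
        ∑ i : Fin n, ∑ j : Fin n, (if i = j then g₀ 0 else (0 : ℝ)) by
      rw [← Finset.sum_sub_distrib]; congr 1; ext i; rw [Finset.sum_sub_distrib]] at hsum
  rw [hdiag] at hsum
  linarith

end Summit.AtomisticToContinuum.Crystallization.Cruxes.LjBilayerHcp.SketchIdeatorOne
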